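import Mathlib
import HarnessLib
import Summits.NavierStokesRegularity.NavierStokesRegularity.Theorems.TypeILiouvilleLambTail
import Summits.NavierStokesRegularity.NavierStokesRegularity.Theorems.TypeILiouvilleStrainLedgerStarved
import Summits.NavierStokesRegularity.NavierStokesRegularity.Theorems.TypeILiouvilleQuiescentVorticity

/-!
# TypeILiouvilleLambTailFading — crux (L) stmt-NavierStokesRegularity-10661 `TypeIliouvilleL`:
# THE LAMB-TAIL VORTICITY BUDGET OF PRINT'S CLASS; INTEGRABLE LAMB TAIL ⟹ FADING VORTICITY ⟹ QUIESCENT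
# (part 2 of `TypeILiouvilleLambTail`)

Helper for stmt-NavierStokesRegularity-10661 (`--supports`); theorems only, no definitions, no named-fact
hypotheses; closes no item; Navier–Stokes regularity is NOT proved here (leafhand seat of the EulerZoomLiouville route).

Class P, `ω = curl v` and the vortex commutator `f = Dv[ω] − Dω[v] = curl(v × ω)` as in part 1.

* §3 `norm_curl_le_of_commutator_majorant` — ★ **THE LAMB-TAIL VORTICITY BUDGET**: for every `s < t < 0` and every
  continuous majorant `‖f(τ,·)‖ ≤ φ τ` on `[s,t]`, `‖ω(t,x)‖ ≤ ‖curl‖ 2^{3/2} K (t−s)^{−1/2} + ∫_s^t φ`: in class P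
  the vorticity at time `t` is paid for ENTIRELY by the vortex commutator on the past (the free caloric part of a
  bounded flow's vorticity flattens away, part 1 §2; the forced part is controlled by comparison, part 1 §1).  With
  `φ ≡ 0`, `s → −∞` this re-proves that generalized Beltrami members are irrotational, hence constant
  (`TypeILiouvilleGeneralizedBeltrami.classP_const_of_convect_comm`), without the caloric Liouville theorem.
* §4 `norm_curl_le_integral_Iic_of_commutator_majorant` / `curl_fading_of_integrable_commutator_tail` /
  `curl_fading_of_integrable_lambCurl_tail` / `quiescent_of_integrable_commutator_tail` — ★ **INTEGRABLE LAMB TAIL ⟹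
  FADING VORTICITY ⟹ QUIESCENT**: if `‖curl(v × ω)(τ,x)‖ ≤ φ τ` (`τ < 0`) with `φ` continuous and integrable on some
  `(−∞,t₀]`, then `‖ω(t,·)‖_∞ ≤ ∫_{(−∞,t]} φ → 0` and the flow is QUIESCENT (tree: `quiescent_of_curl_fading` of
  `TypeILiouvilleQuiescentVorticity`, KNSS Lemma 6.1): the integrable-Lamb-tail stratum of class P lies INSIDE the
  registered residual L_Q (`stub_quiescentLiouville`), and `const_of_integrable_commutator_tail_of_quiescentLiouville`
  records BY NAME (stub statement verbatim as hypothesis) that L_Q decides it.  Contrast: the integrable-GRADIENT tail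
  is EMPTY unconditionally (`TypeILiouvilleStrainLedger.const_of_integrable_gradient_tail`).
* §5 `const_of_lambTail_lt_strainLedger` — ★ **UNCONDITIONAL CELL**: if the Lamb tail is summable faster than the
  strain ledger grows, `e^{−L s} ∫_{(−∞,s]} φ → 0` (`s → −∞`) for a gradient bound `‖∇v‖ ≤ L`, the flow is ONE
  CONSTANT VECTOR (§4 feeds the vorticity bound at `s` into VE `norm_curl_le_mul_exp_integral_norm_fderiv`, then
  `const_of_curl_eq_zero`); instance `const_of_lambTail_exp_decay`: commutator `≤ A e^{μτ}` with `μ > L`.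

READING for the residual of (L): between the generalized-Beltrami stratum (`f ≡ 0`, constant, proved) and the open
residual L_Q sits the scale of Lamb tails `∫_{−∞} sup_x ‖curl(v × ω)‖`; a summable tail already forces fading vorticity,
so a non-constant class-P flow with summable Lamb tail would be a QUIESCENT counterexample to (L) whose strain ledger
outgrows its Lamb tail.
HONEST LABEL: classical estimates on print's class; nothing here proves a registered stub, (L), or Navier–Stokes
regularity; rung 0.
[cite: KochNadirashviliSereginSverak2009, §4 (i), Lemma 6.1, Remark 6.1 (arXiv:0709.3599)]
[cite: GigaGigaSaal2010, §1.1.3] [cite: MajdaBertozziCUP2002, eq. (2.110), eq. (3.80), §2.3]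
-/

noncomputable section
open MeasureTheory Filter Set Function Metric
open scoped Topology ENNReal RealInnerProductSpace Laplacian ContDiff
open Literature.Analysis Literature.Analysis.FluidPDE Literature.Analysis.UnboundedOperators
set_option linter.dupNamespace false
namespace Summit.NavierStokesRegularity.NavierStokesRegularity.Theorems.TypeILiouvilleLambTail

/-! ## §3 The Lamb-tail vorticity budget -/

/-- ★ **THE LAMB-TAIL VORTICITY BUDGET OF PRINT'S CLASS.**  For a class-P flow with `‖v‖ ≤ K`, every window
`[s,t] ⊂ (−∞,0)` and every continuous majorant `φ` of the vortex commutator `Dv[ω] − Dω[v] = curl(v × ω)` on it: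
`‖ω(t,x)‖ ≤ ‖curl‖ · 2^{3/2} K (t−s)^{−1/2} + ∫_s^t φ`.  The vorticity at time `t` is paid for entirely by the vortex
commutator on the past: the free caloric part of a bounded flow's vorticity flattens away (§2), the forced part is
controlled by comparison (§1).  With `φ ≡ 0` and `s → −∞` this re-proves that generalized Beltrami members are
irrotational, hence constant (`TypeILiouvilleGeneralizedBeltrami.classP_const_of_convect_comm`), without the caloric
Liouville theorem. [cite: KochNadirashviliSereginSverak2009, §4 (i) (arXiv:0709.3599)] [cite: GigaGigaSaal2010, §1.1.3] -/
theorem norm_curl_le_of_commutator_majorant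
    {v : ℝ → EuclideanSpace ℝ (Fin 3) → EuclideanSpace ℝ (Fin 3)}
    (hc : ContinuousOn (uncurry v) (Iio 0 ×ˢ univ))
    {K : ℝ} (hKb : ∀ t < 0, ∀ x, ‖v t x‖ ≤ K)
    (hd : ∀ t < 0, IsWeaklyDivFree (v t))
    (hm : ∀ s t : ℝ, s < t → t < 0 → ∀ x,
      v t x = heatExtension (v s) (t - s) x - oseenDuhamel 1 s v v t x)
    {s t : ℝ} (hst : s < t) (ht : t < 0) {φ : ℝ → ℝ} (hφc : Continuous φ)
    (hφ : ∀ τ ∈ Icc s t, ∀ x : EuclideanSpace ℝ (Fin 3),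
      ‖fderiv ℝ (v τ) x (curl (v τ) x) - fderiv ℝ (curl (v τ)) x (v τ x)‖ ≤ φ τ)
    (x : EuclideanSpace ℝ (Fin 3)) :
    ‖curl (v t) x‖ ≤
      ‖curlCLM‖ * ((2 : ℝ) ^ ((Module.finrank ℝ (EuclideanSpace ℝ (Fin 3)) : ℝ) / 2) * (t - s) ^ (-(1 / 2 : ℝ)) * K) +
        ∫ τ in s..t, φ τ := by
  have h1 := norm_curl_sub_heatExtension_curl_le hc ⟨K, hKb⟩ hd hm hst ht hφc hφ x
  have h2 := norm_heatExtension_curl_le hc hKb hd hm (hst.trans ht) (sub_pos.2 hst) x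
  calc ‖curl (v t) x‖ ≤ ‖heatExtension (curl (v s)) (t - s) x‖ +
        ‖curl (v t) x - heatExtension (curl (v s)) (t - s) x‖ := norm_le_insert' _ _
    _ ≤ _ := add_le_add h2 h1

/-! ## §4 Integrable Lamb tail ⟹ fading vorticity ⟹ quiescent -/

/-- **AN INTEGRABLE LAMB TAIL BOUNDS THE VORTICITY BY ITS PAST INTEGRAL**: if the vortex commutator of a class-P flow is
majorised by a continuous `φ` on `(−∞,0)`, integrable on `(−∞,t]` (`t < 0`), then `‖ω(t,x)‖ ≤ ∫_{(−∞,t]} φ`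
(§3 with `s → −∞`). [cite: KochNadirashviliSereginSverak2009, §4 (i) (arXiv:0709.3599)] -/
theorem norm_curl_le_integral_Iic_of_commutator_majorant
    {v : ℝ → EuclideanSpace ℝ (Fin 3) → EuclideanSpace ℝ (Fin 3)}
    (hc : ContinuousOn (uncurry v) (Iio 0 ×ˢ univ))
    (hK : ∃ K : ℝ, ∀ t < 0, ∀ x, ‖v t x‖ ≤ K)
    (hd : ∀ t < 0, IsWeaklyDivFree (v t))
    (hm : ∀ s t : ℝ, s < t → t < 0 → ∀ x,
      v t x = heatExtension (v s) (t - s) x - oseenDuhamel 1 s v v t x)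
    {φ : ℝ → ℝ} (hφc : Continuous φ)
    (hφ : ∀ τ < 0, ∀ x : EuclideanSpace ℝ (Fin 3),
      ‖fderiv ℝ (v τ) x (curl (v τ) x) - fderiv ℝ (curl (v τ)) x (v τ x)‖ ≤ φ τ)
    {t : ℝ} (ht : t < 0) (hint : IntegrableOn φ (Iic t)) (x : EuclideanSpace ℝ (Fin 3)) :
    ‖curl (v t) x‖ ≤ ∫ τ in Iic t, φ τ := by
  obtain ⟨K, hKb⟩ := hK
  have hφ0 : ∀ τ < 0, 0 ≤ φ τ := fun τ hτ => (norm_nonneg _).trans (hφ τ hτ 0)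
  set A : ℝ := ‖curlCLM‖ * ((2 : ℝ) ^ ((Module.finrank ℝ (EuclideanSpace ℝ (Fin 3)) : ℝ) / 2)) * K with hA
  -- the budget on every window `[s,t]`, with the window integral enlarged to the tail integral
  have hwin : ∀ s < t, ‖curl (v t) x‖ ≤ A * (t - s) ^ (-(1 / 2 : ℝ)) + ∫ τ in Iic t, φ τ := by
    intro s hst
    have h := norm_curl_le_of_commutator_majorant hc hKb hd hm hst ht hφc
      (fun τ hτ y => hφ τ (lt_of_le_of_lt hτ.2 ht) y) x
    have hle : ∫ τ in s..t, φ τ ≤ ∫ τ in Iic t, φ τ := by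
      rw [intervalIntegral.integral_of_le hst.le]
      exact setIntegral_mono_set hint
        (ae_restrict_of_forall_mem measurableSet_Iic fun τ hτ => hφ0 τ (lt_of_le_of_lt hτ ht))
        Ioc_subset_Iic_self.eventuallyLE
    have heq : ‖curlCLM‖ * ((2 : ℝ) ^ ((Module.finrank ℝ (EuclideanSpace ℝ (Fin 3)) : ℝ) / 2) *
        (t - s) ^ (-(1 / 2 : ℝ)) * K) = A * (t - s) ^ (-(1 / 2 : ℝ)) := by rw [hA]; ring
    linarith
  -- `s → −∞`
  have hlim : Tendsto (fun s : ℝ => A * (t - s) ^ (-(1 / 2 : ℝ)) + ∫ τ in Iic t, φ τ) atBot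
      (𝓝 (A * 0 + ∫ τ in Iic t, φ τ)) := by
    have h1 : Tendsto (fun s : ℝ => t - s) atBot atTop := by
      simpa [sub_eq_add_neg] using tendsto_atTop_add_const_left atBot t tendsto_neg_atBot_atTop
    have h2 : Tendsto (fun s : ℝ => (t - s) ^ (-(1 / 2 : ℝ))) atBot (𝓝 0) :=
      (tendsto_rpow_neg_atTop (by norm_num : (0 : ℝ) < 1 / 2)).comp h1
    exact (h2.const_mul A).add_const _
  rw [mul_zero, zero_add] at hlim
  exact ge_of_tendsto hlim ((eventually_lt_atBot t).mono fun s hs => hwin s hs)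

/-- ★ **INTEGRABLE LAMB TAIL ⟹ FADING VORTICITY.**  If the vortex commutator `Dv[ω] − Dω[v] = curl(v × ω)` of a
class-P flow is majorised by a continuous `φ` on `(−∞,0)` which is integrable on some past half-line `(−∞,t₀]`, then
`sup_x ‖ω(t,x)‖ → 0` as `t → −∞`: the flow sits in the VORTICITY-FADING stratum.
[cite: KochNadirashviliSereginSverak2009, §4 (i), Lemma 6.1 (arXiv:0709.3599)] -/
theorem curl_fading_of_integrable_commutator_tail
    {v : ℝ → EuclideanSpace ℝ (Fin 3) → EuclideanSpace ℝ (Fin 3)}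
    (hc : ContinuousOn (uncurry v) (Iio 0 ×ˢ univ))
    (hK : ∃ K : ℝ, ∀ t < 0, ∀ x, ‖v t x‖ ≤ K)
    (hd : ∀ t < 0, IsWeaklyDivFree (v t))
    (hm : ∀ s t : ℝ, s < t → t < 0 → ∀ x,
      v t x = heatExtension (v s) (t - s) x - oseenDuhamel 1 s v v t x)
    {φ : ℝ → ℝ} (hφc : Continuous φ)
    (hφ : ∀ τ < 0, ∀ x : EuclideanSpace ℝ (Fin 3),
      ‖fderiv ℝ (v τ) x (curl (v τ) x) - fderiv ℝ (curl (v τ)) x (v τ x)‖ ≤ φ τ)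
    {t₀ : ℝ} (hint : IntegrableOn φ (Iic t₀)) :
    ∀ η : ℝ, 0 < η → ∃ T : ℝ, T < 0 ∧ ∀ τ < T, ∀ x, ‖curl (v τ) x‖ ≤ η := by
  intro η hη
  -- the tail integrals tend to zero
  have hanti : Antitone fun i : ℝ => Iic (-i) := fun i j hij => Iic_subset_Iic.2 (neg_le_neg hij)
  have htail := tendsto_setIntegral_of_antitone (μ := (volume : Measure ℝ)) (f := φ)
    (fun i : ℝ => (measurableSet_Iic : MeasurableSet (Iic (-i)))) hanti ⟨-t₀, by rwa [neg_neg]⟩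
  have hempty : (⋂ i : ℝ, Iic (-i)) = (∅ : Set ℝ) := by
    ext r
    simp only [mem_iInter, mem_Iic, mem_empty_iff_false, iff_false, not_forall, not_le]
    exact ⟨-r + 1, by linarith⟩
  rw [hempty, Measure.restrict_empty, integral_zero_measure] at htail
  obtain ⟨i₀, hi₀⟩ := (htail.eventually (gt_mem_nhds hη)).exists_forall_of_atTop
  set i₁ : ℝ := max i₀ (max (-t₀) 1) with hi₁
  refine ⟨-i₁, by rw [hi₁]; linarith [le_max_right i₀ (max (-t₀) 1), le_max_right (-t₀) 1], fun τ hτ x => ?_⟩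
  have hτt₀ : τ ≤ t₀ := by
    have : -t₀ ≤ i₁ := (le_max_left _ _).trans (le_max_right _ _); linarith
  have hτ0 : τ < 0 := by
    have : (1 : ℝ) ≤ i₁ := (le_max_right _ _).trans (le_max_right _ _); linarith
  have hτi : i₀ ≤ -τ := by
    have : i₀ ≤ i₁ := le_max_left _ _; linarith
  have h1 := norm_curl_le_integral_Iic_of_commutator_majorant hc hK hd hm hφc hφ hτ0
    (hint.mono_set (Iic_subset_Iic.2 hτt₀)) x
  have h2 := hi₀ (-τ) hτi
  rw [neg_neg] at h2
  exact h1.trans h2.le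

/-- The same with the hypothesis written on the CURL OF THE LAMB VECTOR `v × ω` (for the smooth divergence-free
slices of class P, `curl(v × ω) = Dv[ω] − Dω[v]`, `TypeILiouvilleGeneralizedBeltrami.curl_lamb_eq_sub`).
[cite: MajdaBertozziCUP2002, §1.1 (vector identities), §2.3] -/
theorem curl_fading_of_integrable_lambCurl_tail
    {v : ℝ → EuclideanSpace ℝ (Fin 3) → EuclideanSpace ℝ (Fin 3)}
    (hc : ContinuousOn (uncurry v) (Iio 0 ×ˢ univ))
    (hK : ∃ K : ℝ, ∀ t < 0, ∀ x, ‖v t x‖ ≤ K)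
    (hd : ∀ t < 0, IsWeaklyDivFree (v t))
    (hm : ∀ s t : ℝ, s < t → t < 0 → ∀ x,
      v t x = heatExtension (v s) (t - s) x - oseenDuhamel 1 s v v t x)
    {φ : ℝ → ℝ} (hφc : Continuous φ)
    (hlamb : ∀ τ < 0, ∀ x : EuclideanSpace ℝ (Fin 3), ‖curl (fun y => cross (v τ y) (curl (v τ) y)) x‖ ≤ φ τ)
    {t₀ : ℝ} (hint : IntegrableOn φ (Iic t₀)) :
    ∀ η : ℝ, 0 < η → ∃ T : ℝ, T < 0 ∧ ∀ τ < T, ∀ x, ‖curl (v τ) x‖ ≤ η := by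
  obtain ⟨K, hKb⟩ := hK
  obtain ⟨hsm', -⟩ := smooth_and_bounds_of_bounded_ancient_oseenMild hc hd hm hKb
  have hsm : IsSmoothSpaceTimeOn (Iio 0) v := hsm'
  have hslice : ∀ τ < 0, ContDiff ℝ 2 (v τ) := fun τ hτ =>
    (hsm.contDiff_slice (mem_Iio.2 hτ)).of_le (by norm_cast)
  have hdiv' : ∀ τ < 0, VectorCalculus.IsDivFree (v τ) := fun τ hτ =>
    (hd τ hτ).isDivFree_of_contDiff ((hslice τ hτ).of_le (by norm_num))
  refine curl_fading_of_integrable_commutator_tail hc ⟨K, hKb⟩ hd hm hφc (fun τ hτ x => ?_) hint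
  rw [← TypeILiouvilleGeneralizedBeltrami.curl_lamb_eq_sub (hslice τ hτ) (hdiv' τ hτ) x]
  exact hlamb τ hτ x

/-- ★ **INTEGRABLE LAMB TAIL ⟹ QUIESCENT.**  A class-P flow whose vortex commutator has an integrable continuous
majorant on a past half-line is QUIESCENT: the unit oscillation of its slices tends to zero as `t → −∞` (fading
vorticity, then the tree's vorticity dial `TypeILiouvilleStrainLedger.quiescent_of_curl_fading` of
`TypeILiouvilleQuiescentVorticity`, KNSS Lemma 6.1
compactness).  The integrable-Lamb-tail stratum therefore lies inside the registered residual L_Q of crux (L).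
[cite: KochNadirashviliSereginSverak2009, Lemma 6.1 (arXiv:0709.3599)] -/
theorem quiescent_of_integrable_commutator_tail
    {v : ℝ → EuclideanSpace ℝ (Fin 3) → EuclideanSpace ℝ (Fin 3)}
    (hc : ContinuousOn (uncurry v) (Iio 0 ×ˢ univ))
    (hK : ∃ K : ℝ, ∀ t < 0, ∀ x, ‖v t x‖ ≤ K)
    (hd : ∀ t < 0, IsWeaklyDivFree (v t))
    (hm : ∀ s t : ℝ, s < t → t < 0 → ∀ x,
      v t x = heatExtension (v s) (t - s) x - oseenDuhamel 1 s v v t x)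
    {φ : ℝ → ℝ} (hφc : Continuous φ)
    (hφ : ∀ τ < 0, ∀ x : EuclideanSpace ℝ (Fin 3),
      ‖fderiv ℝ (v τ) x (curl (v τ) x) - fderiv ℝ (curl (v τ)) x (v τ x)‖ ≤ φ τ)
    {t₀ : ℝ} (hint : IntegrableOn φ (Iic t₀)) :
    ∀ ε : ℝ, 0 < ε → ∃ T : ℝ, T < 0 ∧ ∀ t < T, ∀ x y : EuclideanSpace ℝ (Fin 3),
      dist x y ≤ 1 → ‖v t x - v t y‖ ≤ ε :=
  TypeILiouvilleStrainLedger.quiescent_of_curl_fading hc hK hd hm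
    (curl_fading_of_integrable_commutator_tail hc hK hd hm hφc hφ hint)

/-- **BY NAME on the registered stub `stub_quiescentLiouville` (L_Q) of crux (L)**: L_Q DECIDES the integrable-Lamb-tail
stratum — if every quiescent member of print's class is constant, then every class-P flow whose vortex commutator has
an integrable continuous majorant on a past half-line is ONE CONSTANT VECTOR.  (Hypothesis = the stub's statement
verbatim; nothing is assumed about its truth.) [cite: KochNadirashviliSereginSverak2009, §4 (i), Lemma 6.1 (arXiv:0709.3599)] -/
theorem const_of_integrable_commutator_tail_of_quiescentLiouville
    (hQ : ∀ v : ℝ → EuclideanSpace ℝ (Fin 3) → EuclideanSpace ℝ (Fin 3),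
      ContinuousOn (Function.uncurry v) (Set.Iio 0 ×ˢ Set.univ) →
      (∃ K : ℝ, ∀ t < 0, ∀ x, ‖v t x‖ ≤ K) →
      (∀ t < 0, Literature.Analysis.FluidPDE.IsWeaklyDivFree (v t)) →
      (∀ s t : ℝ, s < t → t < 0 → ∀ x,
        v t x = Literature.Analysis.UnboundedOperators.heatExtension (v s) (t - s) x -
          Literature.Analysis.FluidPDE.oseenDuhamel 1 s v v t x) →
      (∀ ε : ℝ, 0 < ε → ∃ T : ℝ, T < 0 ∧ ∀ t < T, ∀ x y : EuclideanSpace ℝ (Fin 3),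
        dist x y ≤ 1 → ‖v t x - v t y‖ ≤ ε) →
      ∃ b : EuclideanSpace ℝ (Fin 3), ∀ t < 0, ∀ x, v t x = b)
    {v : ℝ → EuclideanSpace ℝ (Fin 3) → EuclideanSpace ℝ (Fin 3)}
    (hc : ContinuousOn (uncurry v) (Iio 0 ×ˢ univ))
    (hK : ∃ K : ℝ, ∀ t < 0, ∀ x, ‖v t x‖ ≤ K)
    (hd : ∀ t < 0, IsWeaklyDivFree (v t))
    (hm : ∀ s t : ℝ, s < t → t < 0 → ∀ x,
      v t x = heatExtension (v s) (t - s) x - oseenDuhamel 1 s v v t x)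
    {φ : ℝ → ℝ} (hφc : Continuous φ)
    (hφ : ∀ τ < 0, ∀ x : EuclideanSpace ℝ (Fin 3),
      ‖fderiv ℝ (v τ) x (curl (v τ) x) - fderiv ℝ (curl (v τ)) x (v τ x)‖ ≤ φ τ)
    {t₀ : ℝ} (hint : IntegrableOn φ (Iic t₀)) :
    ∃ b : EuclideanSpace ℝ (Fin 3), ∀ t < 0, ∀ x, v t x = b :=
  hQ v hc hK hd hm (quiescent_of_integrable_commutator_tail hc hK hd hm hφc hφ hint)

/-! ## §5 An unconditional cell: Lamb tail summable faster than the strain ledger grows -/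

/-- ★ **LAMB TAIL BELOW THE STRAIN LEDGER ⟹ ONE CONSTANT VECTOR (unconditional).**  Let `v` be a class-P flow with
gradient bound `‖∇v(τ,x)‖ ≤ L` (`τ < 0`; class P always has one) whose vortex commutator is majorised by a continuous
`φ`, integrable on a past half-line, with `e^{−L s} ∫_{(−∞,s]} φ → 0` as `s → −∞`.  Then `v` is constant: by §4 the
vorticity at time `s` is at most the tail `∫_{(−∞,s]} φ`, the strain ledger VE
(`TypeILiouvilleStrainLedger.norm_curl_le_mul_exp_integral_norm_fderiv`) amplifies it by at most `e^{L(t−s)}` up to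
time `t`, and the product tends to zero; so `curl v ≡ 0` and `TypeILiouvilleStrainLedger.const_of_curl_eq_zero`
applies.  Instances: a commutator decaying like `e^{μτ}` with `μ > L`, or vanishing for `τ ≤ T`.
[cite: MajdaBertozziCUP2002, eq. (3.80)] [cite: KochNadirashviliSereginSverak2009, §4 (i), Remark 6.1 (arXiv:0709.3599)] -/
theorem const_of_lambTail_lt_strainLedger
    {v : ℝ → EuclideanSpace ℝ (Fin 3) → EuclideanSpace ℝ (Fin 3)}
    (hc : ContinuousOn (uncurry v) (Iio 0 ×ˢ univ))
    (hK : ∃ K : ℝ, ∀ t < 0, ∀ x, ‖v t x‖ ≤ K)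
    (hd : ∀ t < 0, IsWeaklyDivFree (v t))
    (hm : ∀ s t : ℝ, s < t → t < 0 → ∀ x,
      v t x = heatExtension (v s) (t - s) x - oseenDuhamel 1 s v v t x)
    {L : ℝ} (hL : ∀ τ < 0, ∀ x : EuclideanSpace ℝ (Fin 3), ‖fderiv ℝ (v τ) x‖ ≤ L)
    {φ : ℝ → ℝ} (hφc : Continuous φ)
    (hφ : ∀ τ < 0, ∀ x : EuclideanSpace ℝ (Fin 3),
      ‖fderiv ℝ (v τ) x (curl (v τ) x) - fderiv ℝ (curl (v τ)) x (v τ x)‖ ≤ φ τ)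
    {t₀ : ℝ} (hint : IntegrableOn φ (Iic t₀))
    (hrace : Tendsto (fun s : ℝ => Real.exp (-(L * s)) * ∫ τ in Iic s, φ τ) atBot (𝓝 0)) :
    ∃ b : EuclideanSpace ℝ (Fin 3), ∀ t < 0, ∀ x, v t x = b := by
  refine TypeILiouvilleStrainLedger.const_of_curl_eq_zero hc hK hd hm fun t ht x => ?_
  have ht₁ : min t t₀ ≤ t := min_le_left _ _
  -- VE on `[s,t]` fed by the tail bound at `s`
  have hwin : ∀ s < min t t₀, ‖curl (v t) x‖ ≤
      Real.exp (L * t) * (Real.exp (-(L * s)) * ∫ τ in Iic s, φ τ) := by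
    intro s hs
    have hst : s < t := lt_of_lt_of_le hs ht₁
    have hs0 : s < 0 := hst.trans ht
    have hsint : IntegrableOn φ (Iic s) := hint.mono_set (Iic_subset_Iic.2 (hs.le.trans (min_le_right _ _)))
    have hΩ : ∀ y, ‖curl (v s) y‖ ≤ ∫ τ in Iic s, φ τ := fun y =>
      norm_curl_le_integral_Iic_of_commutator_majorant hc hK hd hm hφc hφ hs0 hsint y
    have h := TypeILiouvilleStrainLedger.norm_curl_le_mul_exp_integral_norm_fderiv hc hK hd hm hst ht
      (g := fun _ => L) continuous_const (fun τ hτ y => hL τ (lt_of_le_of_lt hτ.2 ht) y) hΩ x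
    rw [intervalIntegral.integral_const, smul_eq_mul] at h
    have heq : (∫ τ in Iic s, φ τ) * Real.exp ((t - s) * L) =
        Real.exp (L * t) * (Real.exp (-(L * s)) * ∫ τ in Iic s, φ τ) := by
      rw [← mul_assoc, ← Real.exp_add]; ring_nf
    linarith
  have hlim : Tendsto (fun s : ℝ => Real.exp (L * t) * (Real.exp (-(L * s)) * ∫ τ in Iic s, φ τ)) atBot
      (𝓝 (Real.exp (L * t) * 0)) := hrace.const_mul _
  rw [mul_zero] at hlim
  have hle : ‖curl (v t) x‖ ≤ 0 :=
    ge_of_tendsto hlim ((eventually_lt_atBot (min t t₀)).mono fun s hs => hwin s hs)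
  exact norm_le_zero_iff.1 hle


/-- **EXPONENTIALLY DECAYING LAMB TAIL ABOVE THE GRADIENT RATE ⟹ ONE CONSTANT VECTOR (unconditional instance of
`const_of_lambTail_lt_strainLedger`).**  A class-P flow with gradient bound `‖∇v(τ,x)‖ ≤ L` (`τ < 0`) whose vortex
commutator decays like `‖Dv[ω] − Dω[v]‖(τ,x) ≤ A e^{μτ}` with `μ > L` is constant: its Lamb tail is
`∫_{(−∞,s]} A e^{μτ} dτ = (A/μ) e^{μ s}` and `e^{−Ls}(A/μ)e^{μs} = (A/μ) e^{(μ−L)s} → 0`.  The rate threshold is the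
flow's own maximal strain: generalized Beltrami (`A = 0`) is the floor of this scale.
[cite: MajdaBertozziCUP2002, eq. (3.80)] [cite: KochNadirashviliSereginSverak2009, §4 (i), Remark 6.1 (arXiv:0709.3599)] -/
theorem const_of_lambTail_exp_decay
    {v : ℝ → EuclideanSpace ℝ (Fin 3) → EuclideanSpace ℝ (Fin 3)}
    (hc : ContinuousOn (uncurry v) (Iio 0 ×ˢ univ))
    (hK : ∃ K : ℝ, ∀ t < 0, ∀ x, ‖v t x‖ ≤ K)
    (hd : ∀ t < 0, IsWeaklyDivFree (v t))
    (hm : ∀ s t : ℝ, s < t → t < 0 → ∀ x,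
      v t x = heatExtension (v s) (t - s) x - oseenDuhamel 1 s v v t x)
    {L : ℝ} (hL : ∀ τ < 0, ∀ x : EuclideanSpace ℝ (Fin 3), ‖fderiv ℝ (v τ) x‖ ≤ L)
    {μ A : ℝ} (hμ : L < μ)
    (hA : ∀ τ < 0, ∀ x : EuclideanSpace ℝ (Fin 3),
      ‖fderiv ℝ (v τ) x (curl (v τ) x) - fderiv ℝ (curl (v τ)) x (v τ x)‖ ≤ A * Real.exp (μ * τ)) :
    ∃ b : EuclideanSpace ℝ (Fin 3), ∀ t < 0, ∀ x, v t x = b := by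
  have hL0 : 0 ≤ L := (norm_nonneg _).trans (hL (-1) (by norm_num) 0)
  have hμ0 : 0 < μ := lt_of_le_of_lt hL0 hμ
  have hφc : Continuous fun τ : ℝ => A * Real.exp (μ * τ) :=
    continuous_const.mul (Real.continuous_exp.comp (continuous_const.mul continuous_id))
  have hint : IntegrableOn (fun τ : ℝ => A * Real.exp (μ * τ)) (Iic (-1)) :=
    (integrableOn_exp_mul_Iic hμ0 _).const_mul A
  refine const_of_lambTail_lt_strainLedger hc hK hd hm hL hφc hA hint ?_
  have hfun : ∀ s : ℝ, Real.exp (-(L * s)) * ∫ τ in Iic s, A * Real.exp (μ * τ) =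
      A / μ * Real.exp ((μ - L) * s) := by
    intro s
    rw [integral_const_mul, integral_exp_mul_Iic hμ0, show (μ - L) * s = μ * s + -(L * s) by ring, Real.exp_add]
    field_simp
  have hexp : Tendsto (fun s : ℝ => Real.exp ((μ - L) * s)) atBot (𝓝 0) :=
    Real.tendsto_exp_atBot.comp (tendsto_id.const_mul_atBot (sub_pos.2 hμ))
  have h := hexp.const_mul (A / μ)
  rw [mul_zero] at h
  exact h.congr fun s => (hfun s).symm

end Summit.NavierStokesRegularity.NavierStokesRegularity.Theorems.TypeILiouvilleLambTail

end
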